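import Summits.CriticalPhenomena.Ising3DConformalLimit.Theorems.FKParityRobustnessStrandShadowFootprintFloor
import Summits.CriticalPhenomena.Ising3DConformalLimit.Theorems.FKParityRobustnessStrandShadowComposition
import Literature.Probability.LatticeModels.GKSInequalities
import HarnessLib

/-!
# The density floor and the first-moment floor of the source cluster (line `loop-footprint-strand-mass`,
# crux `StrandShadow`, stmt-CriticalPhenomena-14626)

Support file (lead prover-line-stmt-CriticalPhenomena-14626-c1-0).  Probabilistic corollaries of the landed
footprint floor `StrandShadowFootprint.footprintFloor` (p100356) through the high-temperature dictionary
`⟨σ_A⟩^free·Z^∅ = Z^A` (`StrandShadowSketch.isingCorr_univ_mul_loopO1_empty`), with denominators cleared: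

* `densityFloor` — for `β ≥ 0`, `t = tanh β`, sources `x ≠ y`, an edge `e`:
  `t·Z^∅·(⟨σ_{S∆E_e}⟩ − ⟨σ_S⟩⟨σ_{E_e}⟩) ≤ (1 − t²)·Σ_{F ∈ 𝒯(S) : e ∈ E(K_x(F))} t^{|F|}`, `S = {x,y}`, i.e.
  `P^{xy}[e ∈ E(K_x)] ≥ (t/(1 − t²))·⟨σ_xσ_y ; σ_e⟩/⟨σ_xσ_y⟩` (card `loop-footprint-strand-mass` (E)+(F), idea
  `density-floor-epsilon-exchange`: the FIRST lower bound on the density of the HT source cluster — strand plus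
  blobs — by a thermal correlation; the truncation is `≥ 0` by GKS II, `densityFloor_rhs_nonneg`);
* `firstMomentFloor` — summed over an edge window `B` (Fubini):
  `t·Z^∅·Σ_{e ∈ B}(⟨σ_{S∆E_e}⟩ − ⟨σ_S⟩⟨σ_{E_e}⟩) ≤ (1 − t²)·Σ_{F ∈ 𝒯(S)} t^{|F|}·|E(K_x(F)) ∩ B|`, i.e.
  `E^{xy}|E(K_x) ∩ B| ≥ (t/(1 − t²))·Σ_{e ∈ B} ⟨σ_xσ_y ; σ_e⟩/⟨σ_xσ_y⟩`.
Dimension-free finite-graph statements; on `ℤ³` at `β_c` the right-hand side of the first-moment floor summed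
against an independent second cluster is the line's thermal ε-exchange sum (open stub `stub_thermalOverlapFloor`).
-/

noncomputable section

open Finset SimpleGraph
open Literature.Probability.LatticeModels
open Summit.CriticalPhenomena.Ising3DConformalLimit.Theorems

namespace Summit.CriticalPhenomena.Ising3DConformalLimit.Theorems.StrandShadowFootprint

open scoped Classical symmDiff

variable {V : Type} [Fintype V] [DecidableEq V] (G : SimpleGraph V) [DecidableRel G.Adj]

/-- **Density floor** (probabilistic form of the footprint floor, denominators cleared): for `β ≥ 0`,
`t = tanh β`, sources `x ≠ y` and an edge `e` of a finite graph,
`t·Z^∅·(⟨σ_{S∆E_e}⟩ − ⟨σ_S⟩⟨σ_{E_e}⟩) ≤ (1 − t²)·Σ_{F ∈ 𝒯(S) : e ∈ E(K_x(F))} t^{|F|}` with `S = {x,y}`,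
`E_e = univ.filter (· ∈ e)`, i.e. `P^{xy}[e ∈ E(K_x)] ≥ (t/(1−t²))·⟨σ_xσ_y;σ_e⟩/⟨σ_xσ_y⟩`
(free boundary condition, zero field). -/
theorem densityFloor {β : ℝ} (hβ : 0 ≤ β) {x y : V} (hxy : x ≠ y) {e : Sym2 V}
    (he : e ∈ G.edgeFinset) :
    Real.tanh β * loopO1PartitionFunction G (Real.tanh β) ∅ *
        (isingCorr G Finset.univ β 0 .free
            (({x, y} : Finset V) ∆ (Finset.univ.filter fun w : V => w ∈ e))
          - isingCorr G Finset.univ β 0 .free {x, y} *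
            isingCorr G Finset.univ β 0 .free (Finset.univ.filter fun w : V => w ∈ e))
      ≤ (1 - Real.tanh β ^ 2) *
        ∑ F ∈ (tJoins G Set.univ {x, y}).filter (fun F : Finset (Sym2 V) =>
            e ∈ F ∧ ∀ w ∈ e, (SimpleGraph.fromEdgeSet (↑F : Set (Sym2 V))).Reachable x w),
          Real.tanh β ^ F.card := by
  set t := Real.tanh β with ht_def
  have ht : 0 ≤ t := by
    rw [ht_def, Real.tanh_eq_sinh_div_cosh]
    exact div_nonneg (Real.sinh_nonneg_iff.2 hβ) (Real.cosh_pos _).le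
  have ht1 : t < 1 := Real.tanh_lt_one β
  have hZ0 : 0 < loopO1PartitionFunction G t ∅ := loopO1PartitionFunction_empty_pos G ht
  have hd : ∀ A : Finset V, isingCorr G Finset.univ β 0 .free A * loopO1PartitionFunction G t ∅ =
      loopO1PartitionFunction G t A :=
    fun A => StrandShadowSketch.isingCorr_univ_mul_loopO1_empty G β A
  have h := footprintFloor V G t ht ht1 x y hxy e he
  rw [← hd (({x, y} : Finset V) ∆ (Finset.univ.filter fun w : V => w ∈ e)), ← hd {x, y},
    ← hd (Finset.univ.filter fun w : V => w ∈ e)] at h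
  -- h : t * (Z0 * (cSE * Z0) - cS * Z0 * (cE * Z0)) ≤ (1 - t ^ 2) * Z0 * X
  set Z0 := loopO1PartitionFunction G t ∅
  set cSE := isingCorr G Finset.univ β 0 .free
    (({x, y} : Finset V) ∆ (Finset.univ.filter fun w : V => w ∈ e))
  set cS := isingCorr G Finset.univ β 0 .free {x, y}
  set cE := isingCorr G Finset.univ β 0 .free (Finset.univ.filter fun w : V => w ∈ e)
  set X := ∑ F ∈ (tJoins G Set.univ {x, y}).filter (fun F : Finset (Sym2 V) =>
      e ∈ F ∧ ∀ w ∈ e, (SimpleGraph.fromEdgeSet (↑F : Set (Sym2 V))).Reachable x w), t ^ F.card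
  have h' : (t * Z0 * (cSE - cS * cE)) * Z0 ≤ ((1 - t ^ 2) * X) * Z0 := by
    have e1 : (t * Z0 * (cSE - cS * cE)) * Z0 = t * (Z0 * (cSE * Z0) - cS * Z0 * (cE * Z0)) := by ring
    have e2 : ((1 - t ^ 2) * X) * Z0 = (1 - t ^ 2) * Z0 * X := by ring
    rw [e1, e2]; exact h
  exact le_of_mul_le_mul_right h' hZ0

/-- The truncated correlation on the left of `densityFloor` is nonnegative (GKS II):
`⟨σ_S⟩⟨σ_E⟩ ≤ ⟨σ_{S∆E}⟩`. -/
theorem densityFloor_rhs_nonneg {β : ℝ} (hβ : 0 ≤ β) (S E : Finset V) :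
    0 ≤ isingCorr G Finset.univ β 0 .free (S ∆ E)
        - isingCorr G Finset.univ β 0 .free S * isingCorr G Finset.univ β 0 .free E :=
  sub_nonneg.2 (GKSInequalities.gks_two_holds G (Λ := Finset.univ) (A := S) (B := E) (β := β)
    (h := 0) (bc := .free) hβ le_rfl (Or.inl rfl) (Finset.subset_univ _) (Finset.subset_univ _))

/-- **First-moment floor** (the density floor summed over an edge window `B ⊆ E(G)`, Fubini):
`t·Z^∅·Σ_{e ∈ B}(⟨σ_{S∆E_e}⟩ − ⟨σ_S⟩⟨σ_{E_e}⟩) ≤ (1 − t²)·Σ_{F ∈ 𝒯(S)} t^{|F|}·|E(K_x(F)) ∩ B|`, i.e.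
`E^{xy}|E(K_x) ∩ B| ≥ (t/(1−t²))·Σ_{e∈B}⟨σ_xσ_y;σ_e⟩/⟨σ_xσ_y⟩`: the expected number of window edges of the source
cluster is at least the windowed thermal response of the two-point function. -/
theorem firstMomentFloor {β : ℝ} (hβ : 0 ≤ β) {x y : V} (hxy : x ≠ y) {B : Finset (Sym2 V)}
    (hB : B ⊆ G.edgeFinset) :
    Real.tanh β * loopO1PartitionFunction G (Real.tanh β) ∅ *
        ∑ e ∈ B, (isingCorr G Finset.univ β 0 .free
            (({x, y} : Finset V) ∆ (Finset.univ.filter fun w : V => w ∈ e))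
          - isingCorr G Finset.univ β 0 .free {x, y} *
            isingCorr G Finset.univ β 0 .free (Finset.univ.filter fun w : V => w ∈ e))
      ≤ (1 - Real.tanh β ^ 2) *
        ∑ F ∈ tJoins G Set.univ {x, y}, Real.tanh β ^ F.card *
          ((B.filter fun e => e ∈ F ∧
              ∀ w ∈ e, (SimpleGraph.fromEdgeSet (↑F : Set (Sym2 V))).Reachable x w).card : ℝ) := by
  -- sum the density floor over `e ∈ B`
  have hsum := Finset.sum_le_sum fun e he => densityFloor G hβ hxy (hB he)
  rw [← Finset.mul_sum, ← Finset.mul_sum] at hsum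
  refine hsum.trans (le_of_eq ?_)
  congr 1
  -- Fubini: Σ_e Σ_{F : e ∈ K_x(F)} t^|F| = Σ_F t^|F| · #{e ∈ B : e ∈ K_x(F)}
  calc (∑ e ∈ B, ∑ F ∈ (tJoins G Set.univ {x, y}).filter (fun F : Finset (Sym2 V) =>
            e ∈ F ∧ ∀ w ∈ e, (SimpleGraph.fromEdgeSet (↑F : Set (Sym2 V))).Reachable x w),
          Real.tanh β ^ F.card)
      = ∑ e ∈ B, ∑ F ∈ tJoins G Set.univ {x, y},
          (if e ∈ F ∧ ∀ w ∈ e, (SimpleGraph.fromEdgeSet (↑F : Set (Sym2 V))).Reachable x w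
            then Real.tanh β ^ F.card else 0) := by
        simp only [Finset.sum_filter]
    _ = ∑ F ∈ tJoins G Set.univ {x, y}, ∑ e ∈ B,
          (if e ∈ F ∧ ∀ w ∈ e, (SimpleGraph.fromEdgeSet (↑F : Set (Sym2 V))).Reachable x w
            then Real.tanh β ^ F.card else 0) := Finset.sum_comm
    _ = ∑ F ∈ tJoins G Set.univ {x, y}, Real.tanh β ^ F.card *
          ((B.filter fun e => e ∈ F ∧
              ∀ w ∈ e, (SimpleGraph.fromEdgeSet (↑F : Set (Sym2 V))).Reachable x w).card : ℝ) := by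
        refine Finset.sum_congr rfl fun F _ => ?_
        rw [← Finset.sum_filter, Finset.sum_const, nsmul_eq_mul, mul_comm]

end Summit.CriticalPhenomena.Ising3DConformalLimit.Theorems.StrandShadowFootprint

end
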